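import Summits.Ventures.HSemireg.WedgeCarrierVacuum
import Summits.Ventures.HSemireg.WedgeHankelGlue

/-!
# Venture HSemireg — C15 on the contraction carrier (1/4): the adapted isomorphism ⋀W ≃ ⋀(K^{Fin(n+n)}) and the matching of the recursions

HONEST FRAMING. Part of the Lean index of the computation cell `pub-hsemireg` (seat p3; Sunday enclosure of the
FORMULA-N kernel assets of seats th-7 / th-6, ENCLOSURE-PLAN-p3.md).  Finite-dimensional exterior algebra over a field ONLY:
no variety, no cohomology theory, no semiregularity map is constructed here; nothing here says that HC / HC_CM / HC_AV holds;
no Literature fact is declared or used.  The geometric DICTIONARY (why these ranks are the `HT`-side box ranks of the cell's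
STRUCTURE.md §1 / theory/FORMULA-N.md) lives in theory/FORMULA-N-th7.md PART B §A.3 / §N and is NOT asserted in Lean.

th-7's ASSEMBLY «C15 (THEOREM H) ON THE TREE'S CONTRACTION CARRIER» (theory/th7/WedgeC15.lean v1.4 sha256/16 45d63ee04200ecae (th-7 g3, 17:55Z; PART III = l.2277–2921)), VERBATIM up
to namespaces (`HSemiregC15` ↦ `Summit.Ventures.HSemireg.WedgeC15`; `HSemiregHankel` ↦ `….Wedge.Hankel`; `HSemiregBridge` ↦ `….WedgeBridge`), file 1 of 4
(l.2279–2544) — CONSTRUCTION: linearity of HankelRank's recursion `w` in the coefficient sequence (`w_add`, `w_smul`, `w_zero`, `w_sum_smul`,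
`w_pow_succ`); the basis vectors `xv a = (ℓ_a, 0)`, `yv a = (0, θ_a)` of `W = L × Ann L` with the EXPLICIT two-sided inverse `coordW` / `gmap`
(coordinates `(φ(m_a))_a ++ (coord_{ℓ_a} l)_a`; `coordW_gmap`, `gmap_coordW`) — Mathlib's finite-dimension shortcuts do not elaborate against `W`
(instance paths), hence by hand; `gequiv := LinearEquiv.ofBijective`, `isoQ`, `Ψ : ⋀W ≃ₐ ⋀(K^{Fin (n+n)})` (CliffordAlgebra.equivOfIsometry of the
zero forms), `Ψ_ι`, `Ψ_Yg : Ψ(y_a) = X_a`, `Ψ_Xg : Ψ(x_a) = Y_a` (HankelRank's letters), `Ψ_YN`/`Ψ_XN`, `Ψ_gprod : Ψ(Π_{a<k}(y_a + λ x_a)) = w_k(λ^·)`,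
`Ψ_expSum`.  An INDEPENDENT second construction of the same isomorphism and the same exp-sum / degree-2 / point-pair laws (via `Fin.append` +
`basisOfLinearIndependentOfCardEqFinrank'`) is p3's HOME/lean/enclosure/X2-NOT-FILED-WedgeHankelCarrier.lean (farm rc 0; NOT filed — ×2 of the assembly route).
-/

open Module Set Set.powersetCard

namespace Summit.Ventures.HSemireg.Wedge.Hankel

variable (K : Type*) [Field K] {n : ℕ}

/-- `w_m` is additive in the coefficient sequence. -/
lemma w_add (m : ℕ) (q q' : ℕ → K) : w K n m (fun j => q j + q' j) = w K n m q + w K n m q' := by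
  induction m generalizing q q' with
  | zero => simp only [w, add_smul]
  | succ m ih =>
    have hs : shift K (fun j => q j + q' j) = fun j => shift K q j + shift K q' j := rfl
    rw [w, w, w, hs, ih, ih, add_mul, add_mul]
    abel

/-- `w_m` is homogeneous in the coefficient sequence. -/
lemma w_smul (m : ℕ) (c : K) (q : ℕ → K) : w K n m (fun j => c * q j) = c • w K n m q := by
  induction m generalizing q with
  | zero => simp only [w, mul_smul]
  | succ m ih =>
    have hs : shift K (fun j => c * q j) = fun j => c * shift K q j := rfl
    rw [w, w, hs, ih, ih, smul_add, smul_mul_assoc, smul_mul_assoc]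

/-- `w_m(0) = 0`. -/
lemma w_zero (m : ℕ) : w K n m (fun _ => (0 : K)) = 0 := by
  induction m with
  | zero => simp only [w, zero_smul]
  | succ m ih =>
    have hs : shift K (fun _ : ℕ => (0 : K)) = fun _ => 0 := rfl
    rw [w, hs, ih, zero_mul, zero_mul, add_zero]

/-- finite linear combinations of coefficient sequences. -/
lemma w_sum_smul {ι' : Type*} (s : Finset ι') (c : ι' → K) (q : ι' → ℕ → K) (m : ℕ) :
    w K n m (fun j => ∑ i ∈ s, c i * q i j) = ∑ i ∈ s, c i • w K n m (q i) := by
  classical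
  induction s using Finset.induction_on with
  | empty => simp only [Finset.sum_empty]; exact w_zero K m
  | insert i s hi ih =>
    simp only [Finset.sum_insert hi]
    rw [← ih, ← w_smul, ← w_add]

/-- the exponential sequence: `w_{m+1}(λ^·) = w_m(λ^·)·(x_m + λ y_m)`. -/
lemma w_pow_succ (m : ℕ) (lam : K) :
    w K n (m + 1) (fun j => lam ^ j) = w K n m (fun j => lam ^ j) * (X K n m + lam • Y K n m) := by
  have hs : shift K (fun j => lam ^ j) = fun j => lam * lam ^ j := by
    funext j; rw [shift_apply, pow_succ, mul_comm]
  rw [w, hs, w_smul, mul_add, mul_smul_comm, smul_mul_assoc]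

end Summit.Ventures.HSemireg.Wedge.Hankel

namespace Summit.Ventures.HSemireg.WedgeC15

open Module Summit.Ventures.HSemireg.WedgeBridge Summit.Ventures.HSemireg.Wedge Summit.Ventures.HSemireg.Wedge.Hankel
open CliffordAlgebra (contractLeft)
open ExteriorAlgebra (ι)

variable {K : Type*} [Field K] {n : ℕ} {V : Type*} [AddCommGroup V] [Module K V] (bV : Basis (Fin (n + n)) K V)

/-- the basis vectors `(ℓ_a, 0)` and `(0, θ_a)` of `W = L × Ann L`. -/
noncomputable def xv (a : Fin n) : W K (Lsp bV) := (⟨ℓ bV a, ℓ_mem bV a⟩, 0)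
/-- the basis vector `(0, θ_a)` of `W`. -/
noncomputable def yv (a : Fin n) : W K (Lsp bV) := (0, ⟨θ bV a, θ_mem bV a⟩)

/-- `x_a = ι (ℓ_a, 0)`. -/
lemma Xg_eq (a : Fin n) : Xg bV a = ι K (xv bV a) := rfl
/-- `y_a = ι (0, θ_a)`. -/
lemma Yg_eq (a : Fin n) : Yg bV a = ι K (yv bV a) := rfl

/-- coordinates on `W`: `(l, φ) ↦ (a ↦ φ(m_a)) ++ (a ↦ coord_{ℓ_a}(l))` — the `y`-coordinates FIRST (this is the
relabelling `y_a ↦ e_a`, `x_a ↦ e_{n+a}` that matches HankelRank's `(X_a, Y_a)` with `(y_a, x_a)`). -/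
noncomputable def coordW : W K (Lsp bV) →ₗ[K] (In n → K) where
  toFun w := fun i => Fin.addCases (fun a => (w.2 : Module.Dual K V) (m bV a)) (fun a => bV.coord (Fin.castAdd n a) (w.1 : V)) i
  map_add' w w' := by
    funext i
    refine Fin.addCases (fun a => ?_) (fun a => ?_) i
    · simp only [Fin.addCases_left, Prod.snd_add, Submodule.coe_add, LinearMap.add_apply, Pi.add_apply]
    · simp only [Fin.addCases_right, Prod.fst_add, Submodule.coe_add, map_add, Pi.add_apply]
  map_smul' c w := by
    funext i
    refine Fin.addCases (fun a => ?_) (fun a => ?_) i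
    · simp only [Fin.addCases_left, Prod.smul_snd, Submodule.coe_smul, LinearMap.smul_apply, Pi.smul_apply,
        RingHom.id_apply]
    · simp only [Fin.addCases_right, Prod.smul_fst, Submodule.coe_smul, map_smul, Pi.smul_apply, RingHom.id_apply]

/-- coordinates of `(0, θ_a)`: the unit vector at `castAdd n a`. -/
lemma coordW_yv (a : Fin n) : coordW bV (yv bV a) = Pi.single (Fin.castAdd n a) 1 := by
  funext i
  refine Fin.addCases (fun b => ?_) (fun b => ?_) i
  · simp only [coordW, yv, LinearMap.coe_mk, AddHom.coe_mk, Fin.addCases_left, θ_m, Pi.single_apply,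
      Fin.castAdd_inj]
    by_cases h : a = b
    · subst h; simp
    · rw [if_neg h, if_neg (Ne.symm h)]
  · simp only [coordW, yv, LinearMap.coe_mk, AddHom.coe_mk, Fin.addCases_right, Submodule.coe_zero, map_zero,
      Pi.single_apply]
    rw [if_neg]
    intro h
    have := congrArg Fin.val h
    simp at this
    omega

/-- coordinates of `(ℓ_a, 0)`: the unit vector at `natAdd n a`. -/
lemma coordW_xv (a : Fin n) : coordW bV (xv bV a) = Pi.single (Fin.natAdd n a) 1 := by
  funext i
  refine Fin.addCases (fun b => ?_) (fun b => ?_) i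
  · simp only [coordW, xv, LinearMap.coe_mk, AddHom.coe_mk, Fin.addCases_left, Submodule.coe_zero,
      LinearMap.zero_apply, Pi.single_apply]
    rw [if_neg]
    intro h
    have := congrArg Fin.val h
    simp at this
    omega
  · simp only [coordW, xv, LinearMap.coe_mk, AddHom.coe_mk, Fin.addCases_right, ℓ, Basis.coord_apply,
      Basis.repr_self, Finsupp.single_apply, Pi.single_apply, Fin.natAdd_inj, Fin.castAdd_inj]
    by_cases h : a = b
    · subst h; simp
    · rw [if_neg h, if_neg (Ne.symm h)]

/-- the inverse coordinates: `f ↦ Σ_a f(e_a)·(0, θ_a) + f(e_{n+a})·(ℓ_a, 0)`. -/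
noncomputable def gmap : (In n → K) →ₗ[K] W K (Lsp bV) where
  toFun f := ∑ a : Fin n, (f (Fin.castAdd n a) • yv bV a + f (Fin.natAdd n a) • xv bV a)
  map_add' f f' := by
    simp only [Pi.add_apply, add_smul, ← Finset.sum_add_distrib]
    exact Finset.sum_congr rfl fun a _ => by abel
  map_smul' c f := by
    simp only [Pi.smul_apply, smul_eq_mul, mul_smul, Finset.smul_sum, smul_add, RingHom.id_apply]

/-- `gmap f = Σ_a (f (castAdd a) • (0, θ_a) + f (natAdd a) • (ℓ_a, 0))`. -/
lemma gmap_apply (f : In n → K) :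
    gmap bV f = ∑ a : Fin n, (f (Fin.castAdd n a) • yv bV a + f (Fin.natAdd n a) • xv bV a) := rfl

/-- `gmap (e_{castAdd a}) = (0, θ_a)`. -/
lemma gmap_single_castAdd (a : Fin n) : gmap bV (Pi.single (Fin.castAdd n a) 1) = yv bV a := by
  have castAdd_ne_natAdd : ∀ a b : Fin n, Fin.castAdd n a ≠ Fin.natAdd n b := fun a b h => by
    have := congrArg Fin.val h; simp only [Fin.val_castAdd, Fin.val_natAdd] at this; omega
  rw [gmap_apply, Finset.sum_eq_single a]
  · rw [Pi.single_eq_same, one_smul, Pi.single_apply, if_neg (fun h => castAdd_ne_natAdd a a h.symm), zero_smul,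
      add_zero]
  · intro b _ hb
    rw [Pi.single_apply, if_neg (fun h => hb (Fin.castAdd_inj.mp h)), zero_smul, zero_add, Pi.single_apply,
      if_neg (fun h => castAdd_ne_natAdd a b h.symm), zero_smul]
  · intro h; exact (h (Finset.mem_univ a)).elim

/-- `gmap (e_{natAdd a}) = (ℓ_a, 0)`. -/
lemma gmap_single_natAdd (a : Fin n) : gmap bV (Pi.single (Fin.natAdd n a) 1) = xv bV a := by
  have castAdd_ne_natAdd : ∀ a b : Fin n, Fin.castAdd n a ≠ Fin.natAdd n b := fun a b h => by
    have := congrArg Fin.val h; simp only [Fin.val_castAdd, Fin.val_natAdd] at this; omega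
  rw [gmap_apply, Finset.sum_eq_single a]
  · rw [Pi.single_eq_same, one_smul, Pi.single_apply, if_neg (castAdd_ne_natAdd a a), zero_smul, zero_add]
  · intro b _ hb
    rw [Pi.single_apply, if_neg (castAdd_ne_natAdd b a), zero_smul, zero_add, Pi.single_apply,
      if_neg (fun h => hb ((Fin.natAdd_inj n).mp h)), zero_smul]
  · intro h; exact (h (Finset.mem_univ a)).elim

/-- `coordW ∘ gmap = id` (explicit left inverse). -/
lemma coordW_gmap : (coordW bV).comp (gmap bV) = LinearMap.id := by
  refine (Pi.basisFun K (In n)).ext fun i => ?_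
  rw [LinearMap.comp_apply, LinearMap.id_apply, Pi.basisFun_apply]
  refine Fin.addCases (fun a => ?_) (fun a => ?_) i
  · rw [gmap_single_castAdd, coordW_yv]
  · rw [gmap_single_natAdd, coordW_xv]

/-- `gmap` is injective. -/
lemma gmap_injective : Function.Injective (gmap bV) := by
  intro f f' h
  have := congrArg (coordW bV) h
  rwa [← LinearMap.comp_apply, ← LinearMap.comp_apply, coordW_gmap, LinearMap.id_apply, LinearMap.id_apply] at this

/-- the `castAdd a` coordinate of `w` is `w.2 (m_a)`. -/
lemma coordW_apply_castAdd (w : W K (Lsp bV)) (a : Fin n) :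
    coordW bV w (Fin.castAdd n a) = (w.2 : Module.Dual K V) (m bV a) := by
  simp only [coordW, LinearMap.coe_mk, AddHom.coe_mk, Fin.addCases_left]

/-- the `natAdd a` coordinate of `w` is the `ℓ_a`-coordinate of `w.1`. -/
lemma coordW_apply_natAdd (w : W K (Lsp bV)) (a : Fin n) :
    coordW bV w (Fin.natAdd n a) = bV.coord (Fin.castAdd n a) (w.1 : V) := by
  simp only [coordW, LinearMap.coe_mk, AddHom.coe_mk, Fin.addCases_right]

/-- the `m`-coordinates of an element of `L` vanish. -/
lemma repr_natAdd_of_mem {l : V} (hl : l ∈ Lsp bV) (b : Fin n) : bV.repr l (Fin.natAdd n b) = 0 := by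
  have h := (Submodule.mem_dualAnnihilator _).mp (θ_mem bV b) l hl
  rwa [θ, Basis.coord_apply] at h

/-- an element of `L` is the combination of the `ℓ_a` with its `ℓ`-coordinates. -/
lemma sum_coord_smul_ℓ {l : V} (hl : l ∈ Lsp bV) :
    ∑ a : Fin n, bV.coord (Fin.castAdd n a) l • ℓ bV a = l := by
  conv_rhs => rw [← bV.sum_repr l]
  rw [Fin.sum_univ_add]
  simp only [repr_natAdd_of_mem bV hl, zero_smul, Finset.sum_const_zero, add_zero, Basis.coord_apply, ℓ]

/-- an element of `Ann L` is the combination of the `θ_a` with coefficients its values on the `m_a`. -/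
lemma sum_eval_smul_θ {φ : Module.Dual K V} (hφ : φ ∈ (Lsp bV).dualAnnihilator) :
    ∑ a : Fin n, φ (m bV a) • θ bV a = φ := by
  refine bV.ext fun i => ?_
  refine Fin.addCases (fun b => ?_) (fun b => ?_) i
  · rw [LinearMap.sum_apply, show bV (Fin.castAdd n b) = ℓ bV b from rfl,
      (Submodule.mem_dualAnnihilator φ).mp hφ _ (ℓ_mem bV b)]
    exact Finset.sum_eq_zero fun a _ => by rw [LinearMap.smul_apply, θ_ℓ, smul_zero]
  · rw [LinearMap.sum_apply, show bV (Fin.natAdd n b) = m bV b from rfl, Finset.sum_eq_single b]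
    · rw [LinearMap.smul_apply, θ_m, if_pos rfl, smul_eq_mul, mul_one]
    · intro a _ hab
      rw [LinearMap.smul_apply, θ_m, if_neg hab, smul_zero]
    · intro h; exact (h (Finset.mem_univ b)).elim

/-- `gmap ∘ coordW = id`: the `x_a, y_a` SPAN `W` (no dimension count needed). -/
lemma gmap_coordW (w : W K (Lsp bV)) : gmap bV (coordW bV w) = w := by
  rw [gmap_apply]
  simp only [coordW_apply_castAdd, coordW_apply_natAdd]
  refine Prod.ext ?_ ?_
  · rw [Prod.fst_sum]
    simp only [Prod.fst_add, Prod.smul_fst, yv, xv, smul_zero, zero_add]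
    apply Subtype.ext
    rw [Submodule.coe_sum]
    simp only [Submodule.coe_smul]
    exact sum_coord_smul_ℓ bV w.1.2
  · rw [Prod.snd_sum]
    simp only [Prod.snd_add, Prod.smul_snd, yv, xv, smul_zero, add_zero]
    apply Subtype.ext
    rw [Submodule.coe_sum]
    simp only [Submodule.coe_smul]
    exact sum_eval_smul_θ bV w.2.2

/-- `gmap` is surjective (explicit right inverse `gmap ∘ coordW = id`). -/
lemma gmap_surjective : Function.Surjective (gmap bV) :=
  fun w => ⟨coordW bV w, gmap_coordW bV w⟩

/-- the adapted linear isomorphism `K^{Fin (n+n)} ≃ W`. -/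
noncomputable def gequiv : (In n → K) ≃ₗ[K] W K (Lsp bV) :=
  LinearEquiv.ofBijective (gmap bV) ⟨gmap_injective bV, gmap_surjective bV⟩

/-- `gequiv` is `gmap` as a function. -/
lemma gequiv_apply (f : In n → K) : gequiv bV f = gmap bV f := rfl

/-- `gequiv⁻¹ (0, θ_a) = e_{castAdd a}`. -/
lemma gequiv_symm_yv (a : Fin n) : (gequiv bV).symm (yv bV a) = Pi.single (Fin.castAdd n a) 1 := by
  rw [LinearEquiv.symm_apply_eq, gequiv_apply, gmap_single_castAdd]

/-- `gequiv⁻¹ (ℓ_a, 0) = e_{natAdd a}`. -/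
lemma gequiv_symm_xv (a : Fin n) : (gequiv bV).symm (xv bV a) = Pi.single (Fin.natAdd n a) 1 := by
  rw [LinearEquiv.symm_apply_eq, gequiv_apply, gmap_single_natAdd]

/-- the coordinate map as an isometry of the ZERO quadratic forms, and the induced algebra isomorphism `Ψ`. -/
noncomputable def isoQ :
    (0 : QuadraticForm K (W K (Lsp bV))).IsometryEquiv (0 : QuadraticForm K (In n → K)) :=
  { (gequiv bV).symm with map_app' := fun m => by simp }

/-- the induced algebra isomorphism `⋀W ≃ₐ ⋀(K^{Fin (n+n)})` (CliffordAlgebra.equivOfIsometry of the zero forms). -/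
noncomputable def Ψ : ExteriorAlgebra K (W K (Lsp bV)) ≃ₐ[K] HT K (In n) :=
  CliffordAlgebra.equivOfIsometry (isoQ bV)

/-- `Ψ e` on generators is `e`. -/
lemma Ψ_ι (w : W K (Lsp bV)) : Ψ bV (ι K w) = ι K ((gequiv bV).symm w) := by
  rw [Ψ, CliffordAlgebra.equivOfIsometry_apply]
  show CliffordAlgebra.map _ (CliffordAlgebra.ι _ w) = CliffordAlgebra.ι _ _
  rw [CliffordAlgebra.map_apply_ι]
  rfl

/-- the relabelling: `Ψ(y_a) = X_a`, `Ψ(x_a) = Y_a` (HankelRank's generators). -/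
lemma Ψ_Yg (a : Fin n) : Ψ bV (Yg bV a) = X K n a := by
  rw [Yg_eq, Ψ_ι, gequiv_symm_yv, X_fin K a, Wedge.b, Pi.basisFun_apply]

/-- `Ψ (x_a) = Y_a` (HankelRank's letters). -/
lemma Ψ_Xg (a : Fin n) : Ψ bV (Xg bV a) = Y K n a := by
  rw [Xg_eq, Ψ_ι, gequiv_symm_xv, Y_fin K a, Wedge.b, Pi.basisFun_apply]

/-- `Ψ (y_k) = X_k` (junk-compatible ℕ-indexed form). -/
lemma Ψ_YN (k : ℕ) : Ψ bV (YN bV k) = X K n k := by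
  by_cases h : k < n
  · rw [YN, dif_pos h, Ψ_Yg]
  · rw [YN, dif_neg h, map_zero, X, dif_neg h]

/-- `Ψ (x_k) = Y_k` (junk-compatible ℕ-indexed form). -/
lemma Ψ_XN (k : ℕ) : Ψ bV (XN bV k) = Y K n k := by
  by_cases h : k < n
  · rw [XN, dif_pos h, Ψ_Xg]
  · rw [XN, dif_neg h, map_zero, Y, dif_neg h]

/-- **`Ψ` carries `Π_{a<k}(y_a + λ x_a)` to HankelRank's `w_k(λ^·)`.** -/
theorem Ψ_gprod (lam : K) : ∀ k : ℕ, Ψ bV (gprod bV lam k) = w K n k (fun j => lam ^ j)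
  | 0 => by rw [gprod, map_one, w, pow_zero, one_smul]
  | k + 1 => by
    rw [gprod, map_mul, Ψ_gprod lam k, map_add, map_smul, Ψ_YN, Ψ_XN, w_pow_succ]

/-- … and finite exponential sums to `w_n(q)`, `q_m = Σ_i c_i λ_i^m`. -/
theorem Ψ_expSum {ι' : Type*} (s : Finset ι') (c lam : ι' → K) :
    Ψ bV (∑ i ∈ s, c i • gprod bV (lam i) n) = w K n n (fun m => ∑ i ∈ s, c i * lam i ^ m) := by
  rw [map_sum, w_sum_smul]
  exact Finset.sum_congr rfl fun i _ => by rw [map_smul, Ψ_gprod]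

end Summit.Ventures.HSemireg.WedgeC15
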